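import Summits.BirchSwinnertonDyer.BirchSwinnertonDyer.Theorems.ThetaPartnerAtTwoSignedControlAtTwoCasselsOfPT
import Summits.BirchSwinnertonDyer.Rank1Residual.X11b.KummerTorsionDecomposition
import HarnessLib

/-!
# Route `AlignedTransportAtTwo`, crux C3′ `BSDOfMainConjectureRankOneAtTwo` (stmt-BirchSwinnertonDyer-23008), line `birth`,
# the (L) road of the kernel index: CASSELS–POITOU–TATE IN POSITIVE RANK — local classes lift to a global class
# MODULO THE MORDELL–WEIL OBSTRUCTION (every number field `K : Type`, every prime `p`, any rank)

HONEST FRAMING (cell `bsd-f1-sign2`, attach seat `bsd-line-att-p3` g11 under the C3′ lead lineage `bsd-line-att-p1`;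
`--supports stmt-BirchSwinnertonDyer-23008 --as helper`). BSD is NOT proved; C3′ is NOT closed; nothing is asserted. THEOREMS
ONLY (no `def`, no named fact, no `sorry`). This is step (a)+(b) of `Cruxes/BSDOfMainConjectureRankOneAtTwo/KERINDEX-L-ROAD-att-p3-g10.md`
§3: the positive-rank form of the tree's rank-`0` Cassels theorem `SignedEC.CasselsPT.casselsSurjectivity_H1Sigma_of_poitouTate`
(Greenberg LNM 1716 Prop. 4.13, p. 104: `coker(H¹(K_Σ/K, E[p^∞]) → 𝒫_E^Σ(K))` is dual to the COMPACT Selmer group; with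
`Ш(E/K)[p^∞]` of finite exponent the compact Selmer group is `E(K) ⊗ ℤ_p`, so the image is the orthogonal complement of the
Mordell–Weil classes under the local Tate pairings).

* §1 helpers: `E(K)[p] = 0` from `E(K̄)[p^∞]^{Γ_K} = 0`; `((p^k : ℕ) : ℤ) ≠ 0`.
* §2 `exists_mem_kummerOutside_localization_sub_mem_of_pointObstruction` — **POITOU–TATE EXACTNESS MODULO THE KUMMER
  CONDITIONS AND MODULO THE MORDELL–WEIL CLASSES** at ONE level `p^k`, `k = n + 1 + e`: for a Poitou–Tate family `inv`
  (`IsPerfect`, `SelmerComplement`), a Weil pairing, any finite `S'` and local classes `t_v ∈ H¹(K_v, E[p^k])` with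
  `p^{n+1} t_v ∈ 𝓛_v` on `S'`: IF (Ш-exponent) `p^e • c ∈ κ_{p^k}(E(K))` for every global `c` Kummer at all finite places, AND
  (point obstruction) `∑_{v∈S'} inv_v(t_v ∪ₑ loc_v κ_{p^k}(P)) = 0` for every `P ∈ E(K)`, THEN `loc_v x − t_v ∈ 𝓛_v` on `S'` for
  some `x` Kummer outside `S'`. Proof: the tree's `exists_mem_kummerOutside_localization_sub_mem` (Howard 2.1.11 (i)) needs the
  obstruction to vanish against every test class `c` (Kummer at the finite places and at the infinite `w` with `inv_w` injective);
  by the Ш-exponent `p^e c = p^e κ(P)` for a point `P` (X11b `exists_eq_pow_nsmul_kummerMapTorsion`, using `E(K)[p] = 0`), so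
  `c' = c − κ(P)` is killed by `p^e`, hence `c' = ι_* z` (`CasselsBockstein`) and its local terms die one by one exactly as in the
  rank-`0` file (`CasselsLocalTerms`, `CasselsArchH2`); the `κ(P)`-terms are the point obstruction.
* §3 `exists_subgroupH1_top_of_pointObstruction` — the same in the currency of `Greenberg1999.casselsSurjectivity_H1Sigma`:
  `p`-power-torsion local classes `x_v ∈ H¹(K_v, E(K̄_v))` on a finite `S` (good reduction and `v ∤ p` off `S`) and `x_w` at the
  infinite places, all killed by `p^n`, Kummer lifts `t` of them at level `p^k`, `k = n + 1 + e`, the Ш-exponent hypothesis and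
  the point obstruction `= 0` ⟹ ONE class `y ∈ H¹(⊤, E[p^∞])`, unramified outside `S`, with `loc_v y = x_v` (`v ∈ S`) and
  `loc_w y = x_w` (`w ∣ ∞`). With `Sel_{p^∞}(E/K)` finite (`e` = its exponent, obstruction vacuous) this is the rank-`0` theorem.

The converse (classes that ARE global have vanishing point obstruction) is reciprocity (`SumLocalTermEqZero`); it and the
`KerG`-currency image statement are the companion file `…EulerCharAtTwoKerGImage`.

References: [GreenbergLNM1716] §4 p. 104 and Appendix Prop. 4.13, pp. 120–123; [Cassels1964ArithmeticVII]; [MilneADT2006] I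
Thm. 4.10, Thm. 6.13, Lemma 6.15; [Howard2004HeegnerKolyvagin] Thm. 2.1.11; [SilvermanAEC2009] VIII.§2, X.§4.
bears_on: stmt-BirchSwinnertonDyer-23008 (helper; closes nothing), stmt-BirchSwinnertonDyer-22298 (attach seat's item; untouched).
-/

set_option autoImplicit false
-- the Theorems namespace of this sub repeats the summit name by design (D-0017 nested layout)
set_option linter.dupNamespace false

noncomputable section

open scoped Classical

open CategoryTheory Field NumberField IsDedekindDomain Function WeierstrassCurve
open Literature.NumberTheory.EllipticCurves Literature.NumberTheory.EllipticCurves.GreenbergSelmer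
open Literature.NumberTheory.GaloisRepresentations
open Literature.NumberTheory.GaloisRepresentations.DiscreteGaloisModule (SelmerStructure unramifiedSubgroup mu MuCarrier)
open Literature.NumberTheory.GaloisCohomology
open scoped ContRepresentation

namespace Summit.BirchSwinnertonDyer.BirchSwinnertonDyer.Theorems.AlignedTransportAtTwoEulerCharAtTwoKerGCassels

open Summit.BirchSwinnertonDyer.Rank1Residual.X11b Summit.BirchSwinnertonDyer.Rank1Residual.X11b.KummerPT
open Summit.BirchSwinnertonDyer.Rank1Residual.X11b.LocBridge
open Summit.BirchSwinnertonDyer.Rank1Residual.X11b.Levels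
open Summit.BirchSwinnertonDyer.Rank1Residual.X11b.AcSelmer
open Summit.BirchSwinnertonDyer.Rank1Residual.X11b.Relaxation
open Summit.BirchSwinnertonDyer.Rank1Residual.X11b.KummerDecomp
open Summit.BirchSwinnertonDyer.BirchSwinnertonDyer.Theorems.SignedEC.CasselsPT

/-! ## §1 Helpers -/

section Helpers

variable {K : Type} [Field K] (W : WeierstrassCurve K) (p : ℕ)

/-- `((p ^ k : ℕ) : ℤ) ≠ 0` for a prime `p`. [folklore] -/
theorem natCast_pow_ne_zero [Fact p.Prime] (k : ℕ) : ((p ^ k : ℕ) : ℤ) ≠ 0 := by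
  exact_mod_cast pow_ne_zero k (Fact.out : p.Prime).ne_zero

/-- **`E(K)[p] = 0` from `E(K̄)[p^∞]^{Γ_K} = 0`**: a `K`-rational point killed by `p` is a `Γ_K`-fixed point of `E[p^∞]`.
[cite: GreenbergLNM1716, §4 Appendix, p. 122] -/
theorem eq_zero_of_smul_eq_zero_of_forall_fixed_eq_zero
    (hfix : ∀ a : W.geomPrimaryTorsion p, (∀ σ : absoluteGaloisGroup K, σ • a = a) → a = 0)
    (P : W.toAffine.Point) (hP : p • P = 0) : P = 0 := by
  have hmem : toGeomPoints W P ∈ W.geomPrimaryTorsion p := by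
    rw [geomPrimaryTorsion, AddCommGroup.mem_primaryComponent]
    exact ⟨1, by rw [pow_one, ← map_nsmul, hP, map_zero]⟩
  have h0 : (⟨toGeomPoints W P, hmem⟩ : W.geomPrimaryTorsion p) = 0 := hfix _ fun σ ↦ by
    apply Subtype.ext
    rw [Literature.NumberTheory.EllipticCurves.primaryComponent.coe_smul]
    exact smul_toGeomPoints W σ P
  exact toGeomPoints_injective W ((congrArg Subtype.val h0).trans (map_zero (toGeomPoints W)).symm)

end Helpers

/-! ## §2 Poitou–Tate exactness modulo the Kummer conditions and modulo the Mordell–Weil classes -/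

section Exactness

variable {K : Type} [Field K] [NumberField K] (W : WeierstrassCurve K) [W.IsElliptic] (p : ℕ) [Fact p.Prime]
  (k : ℕ)
  (ew : W.geomTorsion ((p ^ k : ℕ) : ℤ) → W.geomTorsion ((p ^ k : ℕ) : ℤ) → AlgebraicClosure K)
  (hμ : ∀ S T, ew S T ^ (p ^ k) = 1)
  (hadd₁ : ∀ S₁ S₂ T, ew (S₁ + S₂) T = ew S₁ T * ew S₂ T)
  (hadd₂ : ∀ S T₁ T₂, ew S (T₁ + T₂) = ew S T₁ * ew S T₂)
  (hgal : ∀ (σ : absoluteGaloisGroup K) (S T : W.geomTorsion ((p ^ k : ℕ) : ℤ)), σ • ew S T = ew (σ • S) (σ • T))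
  (halt : ∀ T, ew T T = 1) (hnondeg : ∀ T, (∀ S, ew S T = 1) → T = 0)

include halt hnondeg in
/-- **POITOU–TATE EXACTNESS MODULO THE KUMMER CONDITIONS AND MODULO THE MORDELL–WEIL CLASSES (every number field, any
rank).** Level `p^k`, `k = n + 1 + e`; `E(K̄)[p^∞]^{Γ_K} = 0`; `inv` a Poitou–Tate family at level `p^k` with `IsPerfect` and
`SelmerComplement`; a Weil pairing `ew` on `E[p^k]`; `S'` any finite set of places; local classes `t_v ∈ H¹(K_v, E[p^k])` with
`p^{n+1} • t_v ∈ 𝓛_v` for `v ∈ S'`. Suppose (Ш-EXPONENT) every global class `c ∈ H¹(K, E[p^k])` satisfying the Kummer condition at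
every finite place has `p^e • c ∈ κ_{p^k}(E(K))`, and (POINT OBSTRUCTION) `∑_{v∈S'} inv_v(t_v ∪ₑ loc_v κ_{p^k}(P)) = 0` for every
`P ∈ E(K)`. Then there is `x ∈ kummerOutside W (p^k) S'` with `loc_v x − t_v ∈ 𝓛_v` for every `v ∈ S'`. In rank `0` with `p^e` the
exponent of the Selmer group relaxed at `∞` the obstruction hypothesis is vacuous and this is step 3–4 of the tree's Cassels theorem.
[cite: GreenbergLNM1716, §4 p. 104 and Appendix Prop. 4.13, p. 121–122] [cite: MilneADT2006, Ch. I, Thm. 4.10(b), Lemma 6.15]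
[cite: Howard2004HeegnerKolyvagin, Thm. 2.1.11 (arXiv:1202.6340 p. 6)] -/
theorem exists_mem_kummerOutside_localization_sub_mem_of_pointObstruction
    (hfix : ∀ a : W.geomPrimaryTorsion p, (∀ σ : absoluteGaloisGroup K, σ • a = a) → a = 0)
    {n e : ℕ} (hk : n + 1 + e = k)
    {inv : LocalInvariants K (p ^ k)} (hperf : inv.IsPerfect) (hcompl : inv.SelmerComplement)
    (S' : Finset (Place K))
    (t : Π v : Place K, galoisCohomology ((W.torsionGaloisModule ((p ^ k : ℕ) : ℤ)).toLocal v) 1)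
    (htL : ∀ v ∈ S', p ^ (n + 1) • t v ∈ W.kummerSelmerStructure ((p ^ k : ℕ) : ℤ) v)
    (hSha : ∀ c : galoisCohomology (W.torsionGaloisModule ((p ^ k : ℕ) : ℤ)) 1,
      (∀ v : HeightOneSpectrum (𝓞 K),
        galoisCohomology.localization (W.torsionGaloisModule ((p ^ k : ℕ) : ℤ)) (Sum.inr v) 1 c ∈
          W.kummerSelmerStructure ((p ^ k : ℕ) : ℤ) (Sum.inr v)) →
      p ^ e • c ∈ (kummerMapTorsion W ((p ^ k : ℕ) : ℤ)
        (W.zsmul_geomPoints_surjective_holds (natCast_pow_ne_zero p k))).range)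
    (hobs : ∀ P : W.toAffine.Point,
      ∑ v ∈ S', invWeilPairing W (p ^ k) ew hμ hadd₁ hadd₂ hgal inv v (t v)
        (galoisCohomology.localization (W.torsionGaloisModule ((p ^ k : ℕ) : ℤ)) v 1
          (kummerMapTorsion W ((p ^ k : ℕ) : ℤ)
            (W.zsmul_geomPoints_surjective_holds (natCast_pow_ne_zero p k)) P)) = 0) :
    ∃ x ∈ kummerOutside W (p ^ k) S', ∀ v ∈ S',
      galoisCohomology.localization (W.torsionGaloisModule ((p ^ k : ℕ) : ℤ)) v 1 x - t v ∈
        W.kummerSelmerStructure ((p ^ k : ℕ) : ℤ) v := by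
  classical
  have hprime : p.Prime := Fact.out
  have hk0 : 0 < k := by omega
  have hek : e ≤ k := by omega
  haveI : NeZero (p ^ k) := ⟨pow_ne_zero k hprime.ne_zero⟩
  have hNz : ((p ^ k : ℕ) : ℤ) ≠ 0 := natCast_pow_ne_zero p k
  have hez : ((p ^ e : ℕ) : ℤ) ≠ 0 := natCast_pow_ne_zero p e
  have hdz : ((p ^ (n + 1) : ℕ) : ℤ) ≠ 0 := natCast_pow_ne_zero p (n + 1)
  have hlev : ((p ^ e : ℕ) : ℤ) * ((p ^ (n + 1) : ℕ) : ℤ) = ((p ^ k : ℕ) : ℤ) := by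
    rw [← hk]; push_cast; ring
  have hE : ∀ P : W.toAffine.Point, p • P = 0 → P = 0 :=
    eq_zero_of_smul_eq_zero_of_forall_fixed_eq_zero W p hfix
  -- the Kummer map at level `p^k`
  set κ : W.toAffine.Point →+ galH1Torsion W ((p ^ k : ℕ) : ℤ) :=
    kummerMapTorsion W ((p ^ k : ℕ) : ℤ) (W.zsmul_geomPoints_surjective_holds (natCast_pow_ne_zero p k)) with hκdef
  -- notation for the localisation maps and the pairing
  set loc : ∀ v : Place K, galoisCohomology (W.torsionGaloisModule ((p ^ k : ℕ) : ℤ)) 1 →+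
      galoisCohomology ((W.torsionGaloisModule ((p ^ k : ℕ) : ℤ)).toLocal v) 1 :=
    fun v ↦ galoisCohomology.localization (W.torsionGaloisModule ((p ^ k : ℕ) : ℤ)) v 1 with hlocdef
  refine exists_mem_kummerOutside_localization_sub_mem W p k ew hμ hadd₁ hadd₂ hgal halt hnondeg hk0 hperf hcompl S' t
    (fun c hcfin hcinf ↦ ?_)
  -- the test class `c`, read in `galH1Torsion`: `p^e • c = p^e • κ P`
  set c₀ : galH1Torsion W ((p ^ k : ℕ) : ℤ) := c with hc₀def
  have hce : p ^ e • c₀ ∈ κ.range := hSha c hcfin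
  have hz : p ^ (k - e) • (p ^ e • c₀) = 0 := by
    rw [smul_smul, ← pow_add, Nat.sub_add_cancel hek]
    exact pow_nsmul_galH1Torsion_eq_zero W p k rfl c₀
  obtain ⟨P, hP⟩ := exists_eq_pow_nsmul_kummerMapTorsion W (natCast_pow_ne_zero p k) p k rfl hE hce
    (Nat.sub_le k e) hz
  rw [Nat.sub_sub_self hek] at hP
  -- `c' = c - κ P` is killed by `p^e`, hence `c' = ι_* z`
  set c' : galH1Torsion W ((p ^ k : ℕ) : ℤ) := c₀ - κ P with hc'def
  have hc'e : p ^ e • c' = 0 := by rw [hc'def, smul_sub, hP, sub_self]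
  obtain ⟨z, hz'⟩ := exists_map_torsionInclusion_eq_of_nsmul_eq_zero_of_eq W (pow_ne_zero e hprime.ne_zero)
    hdz hlev (forall_fixed_geomTorsion_eq_zero W p e hfix) (Dvd.intro _ hlev) c' hc'e
  -- `loc_v κ P ∈ 𝓛_v` everywhere, so `loc_v c' ∈ 𝓛_v` wherever `loc_v c ∈ 𝓛_v`
  have hκL : ∀ v : Place K, loc v (κ P) ∈ W.kummerSelmerStructure ((p ^ k : ℕ) : ℤ) v := fun v ↦
    localization_kummerMapTorsion_mem W (p ^ k) v P
  have hlocc' : ∀ v : Place K, loc v c' = loc v c - loc v (κ P) := fun v ↦ map_sub (loc v) c₀ (κ P)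
  have hc'L : ∀ v : Place K, loc v c ∈ W.kummerSelmerStructure ((p ^ k : ℕ) : ℤ) v →
      loc v c' ∈ W.kummerSelmerStructure ((p ^ k : ℕ) : ℤ) v := fun v hv ↦ by
    rw [hlocc' v]
    exact sub_mem hv (hκL v)
  -- split the obstruction: `c = c' + κ P`
  have hsplit : ∀ v : Place K, invWeilPairing W (p ^ k) ew hμ hadd₁ hadd₂ hgal inv v (t v) (loc v c) =
      invWeilPairing W (p ^ k) ew hμ hadd₁ hadd₂ hgal inv v (t v) (loc v c') +
      invWeilPairing W (p ^ k) ew hμ hadd₁ hadd₂ hgal inv v (t v) (loc v (κ P)) := fun v ↦ by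
    rw [← map_add, hlocc' v, sub_add_cancel]
  rw [Finset.sum_congr rfl fun v _ ↦ hsplit v, Finset.sum_add_distrib, hobs P, add_zero]
  -- the `c'`-terms vanish one by one
  refine Finset.sum_eq_zero fun v hv ↦ ?_
  have key : loc v (galoisCohomology.map (W.torsionInclusion (Dvd.intro _ hlev)) 1 z) ∈
        W.kummerSelmerStructure ((p ^ k : ℕ) : ℤ) v →
      invWeilPairing W (p ^ k) ew hμ hadd₁ hadd₂ hgal inv v (t v)
        (loc v (galoisCohomology.map (W.torsionInclusion (Dvd.intro _ hlev)) 1 z)) = 0 := by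
    intro hmem
    haveI : CharZero (Place.Completion v) :=
      charZero_of_injective_algebraMap (algebraMap K (Place.Completion v)).injective
    rw [hlocdef, localization_map_one] at hmem ⊢
    obtain ⟨R, hR, hEq⟩ := exists_eq_nsmul_localKummerClass_of_map_torsionInclusion_mem W
      (E := Place.Completion v) (p ^ (n + 1)) hlev hez hNz hmem
    rw [hEq]
    exact invWeilPairing_nsmul_eq_zero_of_nsmul_mem W (p ^ k) ew hμ hadd₁ hadd₂ hgal halt inv v (p ^ (n + 1))
      (htL v hv) (W.localKummerClass_mem_kummerLocalConditionAt _ hNz R hR)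
  rw [hz'] at key
  rcases v with w | u
  · -- an infinite place: `inv_w = 0` or `inv_w` injective
    rcases addMonoidHom_galoisCohomology_two_mu_inl_eq_zero_or_injective (p ^ k) w (inv (Sum.inl w)) with h0 | hinj
    · rw [invWeilPairing_apply, h0, AddMonoidHom.zero_apply]
    · exact key (hc'L (Sum.inl w) (hcinf w hinj))
  · exact key (hc'L (Sum.inr u) (hcfin u))

end Exactness


/-! ## §3 The currency of the Greenberg facts: local classes in `H¹(K_v, E(K̄_v))[p^∞]` are the restrictions of ONE class of
`H¹(K_Σ/K, E[p^∞])` as soon as the point obstruction of their Kummer lifts vanishes -/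

section Greenberg

variable {K : Type} [Field K] [NumberField K] (W : WeierstrassCurve K) [W.IsElliptic] (p : ℕ) [Fact p.Prime]
  (k : ℕ)
  (ew : W.geomTorsion ((p ^ k : ℕ) : ℤ) → W.geomTorsion ((p ^ k : ℕ) : ℤ) → AlgebraicClosure K)
  (hμ : ∀ S T, ew S T ^ (p ^ k) = 1)
  (hadd₁ : ∀ S₁ S₂ T, ew (S₁ + S₂) T = ew S₁ T * ew S₂ T)
  (hadd₂ : ∀ S T₁ T₂, ew S (T₁ + T₂) = ew S T₁ * ew S T₂)
  (hgal : ∀ (σ : absoluteGaloisGroup K) (S T : W.geomTorsion ((p ^ k : ℕ) : ℤ)), σ • ew S T = ew (σ • S) (σ • T))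
  (halt : ∀ T, ew T T = 1) (hnondeg : ∀ T, (∀ S, ew S T = 1) → T = 0)

include halt hnondeg in
/-- **CASSELS–POITOU–TATE IN POSITIVE RANK (the currency of `Greenberg1999.casselsSurjectivity_H1Sigma`).** `K` a number field,
`E(K̄)[p^∞]^{Γ_K} = 0`, `S` a finite set of finite places off which `E` has good reduction and `v ∤ p`; `p`-power-torsion local
classes `x_v` (`v ∈ S`) and `x_w` (`w ∣ ∞`) of `H¹(K_v, E(K̄_v))`, all killed by `p^n`; a level `p^k`, `k = n + 1 + e`, a
Poitou–Tate family `inv` at that level, a Weil pairing `ew`, and Kummer lifts `t_v ∈ H¹(K_v, E[p^k])` of the `x_v`, `x_w`. IF every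
global class of `H¹(K, E[p^k])` Kummer at all finite places has `p^e •` it in `κ_{p^k}(E(K))` (Ш-exponent) AND
`∑_{v ∈ ∞ ∪ S} inv_v(t_v ∪ₑ loc_v κ_{p^k}(P)) = 0` for every `P ∈ E(K)` (point obstruction), THEN there is ONE class
`y ∈ H¹(⊤, E[p^∞])`, unramified outside `S`, with `loc_v y = x_v` for `v ∈ S` and `loc_w y = x_w` for every infinite `w`.
Proof: §2 at `S' = ∞ ∪ S`, then `y = res_⊤ ι_* ξ` exactly as in the rank-`0` file (`CasselsLift`). Greenberg p. 104: the
cokernel of `H¹(K_Σ/K, E[p^∞]) → 𝒫_E^Σ(K)` is dual to the compact Selmer group, `= E(K) ⊗ ℤ_p` under the Ш-exponent hypothesis.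
[cite: GreenbergLNM1716, §4 p. 104 and Appendix Prop. 4.13, pp. 121–122] [cite: Cassels1964ArithmeticVII, Thm.]
[cite: MilneADT2006, Ch. I, Thm. 4.10, Thm. 6.13 and Lemma 6.15] -/
theorem exists_subgroupH1_top_of_pointObstruction
    (hE0 : Nat.card (MulAction.fixedPoints (absoluteGaloisGroup K) (W.geomPrimaryTorsion p)) = 1)
    (S : Finset (HeightOneSpectrum (𝓞 K)))
    (hS : ∀ v ∉ S, ((p : ℕ) : 𝓞 K) ∉ v.asIdeal ∧ W.HasGoodReductionAt v)
    (x : ∀ v : HeightOneSpectrum (𝓞 K),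
      discreteH1 (localSubgroup (⊤ : Subgroup (absoluteGaloisGroup K)) (v.adicCompletion K))
        (localPoints W (v.adicCompletion K)))
    (xi : ∀ w : InfinitePlace K,
      discreteH1 (localSubgroup (⊤ : Subgroup (absoluteGaloisGroup K)) w.Completion) (localPoints W w.Completion))
    {n e : ℕ} (hk : n + 1 + e = k)
    (hxn : ∀ v ∈ S, p ^ n • x v = 0) (hxin : ∀ w, p ^ n • xi w = 0)
    {inv : LocalInvariants K (p ^ k)} (hperf : inv.IsPerfect) (hcompl : inv.SelmerComplement)
    (hSha : ∀ c : galoisCohomology (W.torsionGaloisModule ((p ^ k : ℕ) : ℤ)) 1,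
      (∀ v : HeightOneSpectrum (𝓞 K),
        galoisCohomology.localization (W.torsionGaloisModule ((p ^ k : ℕ) : ℤ)) (Sum.inr v) 1 c ∈
          W.kummerSelmerStructure ((p ^ k : ℕ) : ℤ) (Sum.inr v)) →
      p ^ e • c ∈ (kummerMapTorsion W ((p ^ k : ℕ) : ℤ)
        (W.zsmul_geomPoints_surjective_holds (natCast_pow_ne_zero p k))).range)
    (t : Π v : Place K, galoisCohomology ((W.torsionGaloisModule ((p ^ k : ℕ) : ℤ)).toLocal v) 1)
    (htS : ∀ v ∈ S,
      resH1Hom (Literature.NumberTheory.EllipticCurves.subgroupIncl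
          (localSubgroup (⊤ : Subgroup (absoluteGaloisGroup K)) (v.adicCompletion K)))
        (AddMonoidHom.id (localPoints W (v.adicCompletion K))) (fun _ _ ↦ rfl)
        (galoisCohomology.map (W.torsionPointsMapIntertwining ((p ^ k : ℕ) : ℤ) (v.adicCompletion K)) 1
          (t (Sum.inr v))) = x v)
    (hti : ∀ w : InfinitePlace K,
      resH1Hom (Literature.NumberTheory.EllipticCurves.subgroupIncl
          (localSubgroup (⊤ : Subgroup (absoluteGaloisGroup K)) w.Completion))
        (AddMonoidHom.id (localPoints W w.Completion)) (fun _ _ ↦ rfl)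
        (galoisCohomology.map (W.torsionPointsMapIntertwining ((p ^ k : ℕ) : ℤ) w.Completion) 1
          (t (Sum.inl w))) = xi w)
    (hobs : ∀ P : W.toAffine.Point,
      ∑ v ∈ (Finset.univ.image Sum.inl ∪ S.image Sum.inr : Finset (Place K)),
        invWeilPairing W (p ^ k) ew hμ hadd₁ hadd₂ hgal inv v (t v)
          (galoisCohomology.localization (W.torsionGaloisModule ((p ^ k : ℕ) : ℤ)) v 1
            (kummerMapTorsion W ((p ^ k : ℕ) : ℤ)
              (W.zsmul_geomPoints_surjective_holds (natCast_pow_ne_zero p k)) P)) = 0) :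
    ∃ y : W.subgroupH1 p (⊤ : Subgroup (absoluteGaloisGroup K)),
      y ∈ GreenbergVatsal2000.unramifiedOutside (⊤ : Subgroup (absoluteGaloisGroup K)) (W.geomPrimaryTorsion p) p
          (↑S : Set (HeightOneSpectrum (𝓞 K))) ∧
      (∀ v ∈ S, W.localResOver p ⊤ (v.adicCompletion K) y = x v) ∧
      (∀ w : InfinitePlace K, W.localResOver p ⊤ w.Completion y = xi w) := by
  have hprime : p.Prime := Fact.out
  haveI : CompactSpace (absoluteGaloisGroup K) := absoluteGaloisGroup_compactSpace K
  have hfix : ∀ a : W.geomPrimaryTorsion p, (∀ σ : absoluteGaloisGroup K, σ • a = a) → a = 0 :=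
    forall_fixed_eq_zero_of_natCard_fixedPoints_eq_one W p hE0
  haveI : NeZero (p ^ k) := ⟨pow_ne_zero k hprime.ne_zero⟩
  -- the set `S' = ∞ ∪ S`
  obtain ⟨S', hS'def⟩ : ∃ S' : Finset (Place K), S' = Finset.univ.image Sum.inl ∪ S.image Sum.inr := ⟨_, rfl⟩
  rw [← hS'def] at hobs
  have hS'inr : ∀ u : HeightOneSpectrum (𝓞 K), (Sum.inr u : Place K) ∈ S' ↔ u ∈ S := fun u ↦ by
    simp only [hS'def, Finset.mem_union, Finset.mem_image, Finset.mem_univ, true_and, reduceCtorEq,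
      exists_false, Sum.inr.injEq, exists_eq_right, false_or]
  have hS'inl : ∀ w : InfinitePlace K, (Sum.inl w : Place K) ∈ S' := fun w ↦ by
    simp only [hS'def, Finset.mem_union, Finset.mem_image, Finset.mem_univ, true_and, exists_apply_eq_apply,
      true_or]
  -- `p^{n+1} • t_v ∈ 𝓛_v` on `S'`: its image in `H¹(Γ_{K_v}, E(K̄_v))` restricts to `p^{n+1} • x_v = 0` along a bijection
  have htL : ∀ v ∈ S', p ^ (n + 1) • t v ∈ W.kummerSelmerStructure ((p ^ k : ℕ) : ℤ) v := by
    rintro (w | u) hv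
    · have hbij := bijective_resH1Hom_subgroupIncl (localPoints W w.Completion)
        (localSubgroup (⊤ : Subgroup (absoluteGaloisGroup K)) w.Completion) mem_localSubgroup_top
      change galoisCohomology.map (W.torsionPointsMapIntertwining ((p ^ k : ℕ) : ℤ) w.Completion) 1
        (p ^ (n + 1) • t (Sum.inl w)) = 0
      refine (map_nsmul (galoisCohomology.map (W.torsionPointsMapIntertwining ((p ^ k : ℕ) : ℤ) w.Completion) 1)
        (p ^ (n + 1)) (t (Sum.inl w))).trans ?_
      have h : resH1Hom (Literature.NumberTheory.EllipticCurves.subgroupIncl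
            (localSubgroup (⊤ : Subgroup (absoluteGaloisGroup K)) w.Completion))
          (AddMonoidHom.id (localPoints W w.Completion)) (fun _ _ ↦ rfl)
          (p ^ (n + 1) • galoisCohomology.map (W.torsionPointsMapIntertwining ((p ^ k : ℕ) : ℤ) w.Completion) 1
            (t (Sum.inl w))) = 0 := by
        refine (map_nsmul _ (p ^ (n + 1)) _).trans ?_
        rw [hti w]
        exact pow_nsmul_eq_zero_of_le p (Nat.le_succ n) _ (hxin w)
      exact hbij.1 (h.trans (map_zero _).symm)
    · have hu : u ∈ S := (hS'inr u).mp hv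
      have hbij := bijective_resH1Hom_subgroupIncl (localPoints W (u.adicCompletion K))
        (localSubgroup (⊤ : Subgroup (absoluteGaloisGroup K)) (u.adicCompletion K)) mem_localSubgroup_top
      change galoisCohomology.map (W.torsionPointsMapIntertwining ((p ^ k : ℕ) : ℤ) (u.adicCompletion K)) 1
        (p ^ (n + 1) • t (Sum.inr u)) = 0
      refine (map_nsmul (galoisCohomology.map (W.torsionPointsMapIntertwining ((p ^ k : ℕ) : ℤ)
        (u.adicCompletion K)) 1) (p ^ (n + 1)) (t (Sum.inr u))).trans ?_
      have h : resH1Hom (Literature.NumberTheory.EllipticCurves.subgroupIncl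
            (localSubgroup (⊤ : Subgroup (absoluteGaloisGroup K)) (u.adicCompletion K)))
          (AddMonoidHom.id (localPoints W (u.adicCompletion K))) (fun _ _ ↦ rfl)
          (p ^ (n + 1) • galoisCohomology.map (W.torsionPointsMapIntertwining ((p ^ k : ℕ) : ℤ)
            (u.adicCompletion K)) 1 (t (Sum.inr u))) = 0 := by
        refine (map_nsmul _ (p ^ (n + 1)) _).trans ?_
        rw [htS u hu]
        exact pow_nsmul_eq_zero_of_le p (Nat.le_succ n) _ (hxn u hu)
      exact hbij.1 (h.trans (map_zero _).symm)
  -- §2: a global class `ξ`, Kummer outside `S'`, with `loc_v ξ − t_v ∈ 𝓛_v` on `S'`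
  obtain ⟨ξ, hξout, hξS'⟩ := exists_mem_kummerOutside_localization_sub_mem_of_pointObstruction W p k ew hμ hadd₁ hadd₂
    hgal halt hnondeg hfix hk hperf hcompl S' t htL hSha hobs
  -- the class `y = res_⊤ ι_* ξ`
  refine ⟨resH1Hom (Literature.NumberTheory.EllipticCurves.subgroupIncl (⊤ : Subgroup (absoluteGaloisGroup K)))
      (AddMonoidHom.id (W.geomPrimaryTorsion p)) (fun _ _ ↦ rfl) (torsionPowToPrimaryH1 W p k ξ), ?_, ?_, ?_⟩
  · -- unramified outside `S`
    rw [GreenbergVatsal2000.mem_unramifiedOutside_iff]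
    intro v hvS hvp σ
    rw [show Literature.NumberTheory.EllipticCurves.conjH1 ⊤ (W.geomPrimaryTorsion p) σ = AddMonoidHom.id _ from
      W.conjH1_of_mem_holds p ⊤ (Subgroup.mem_top σ), AddMonoidHom.id_apply]
    apply res_torsionPowToPrimaryH1_mem_unramifiedKer W p k ξ
    have hvS₀ : v ∉ S := fun h ↦ hvS (Finset.mem_coe.mpr h)
    have hvS' : (Sum.inr v : Place K) ∉ S' := fun h ↦ hvS₀ ((hS'inr v).mp h)
    have hmem := (mem_kummerOutside_iff W (p ^ k) S' ξ).mp hξout (Sum.inr v) hvS'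
    rw [← kummerSelmerStructure_inr_eq_unramifiedSubgroup W p k hvp (hS v hvS₀).2]
    exact hmem
  · -- the finite places of `S`
    intro v hv
    have hvS' : (Sum.inr v : Place K) ∈ S' := (hS'inr v).mpr hv
    have hsub := map_torsionPointsMapIntertwining_eq_of_sub_mem W (hξS' (Sum.inr v) hvS')
    rw [localResOver_top_res_torsionPowToPrimaryH1 W p k (v.adicCompletion K) ξ, ← htS v hv]
    exact congrArg (resH1Hom (Literature.NumberTheory.EllipticCurves.subgroupIncl
        (localSubgroup (⊤ : Subgroup (absoluteGaloisGroup K)) (v.adicCompletion K)))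
      (AddMonoidHom.id (localPoints W (v.adicCompletion K))) (fun _ _ ↦ rfl)) hsub
  · -- the infinite places
    intro w
    have hsub := map_torsionPointsMapIntertwining_eq_of_sub_mem W (hξS' (Sum.inl w) (hS'inl w))
    rw [localResOver_top_res_torsionPowToPrimaryH1 W p k w.Completion ξ, ← hti w]
    exact congrArg (resH1Hom (Literature.NumberTheory.EllipticCurves.subgroupIncl
        (localSubgroup (⊤ : Subgroup (absoluteGaloisGroup K)) w.Completion))
      (AddMonoidHom.id (localPoints W w.Completion)) (fun _ _ ↦ rfl)) hsub

end Greenberg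

end Summit.BirchSwinnertonDyer.BirchSwinnertonDyer.Theorems.AlignedTransportAtTwoEulerCharAtTwoKerGCassels

end
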